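import HarnessLib
import Summits.RiemannHypothesis.Statement
import Literature.NumberTheory.LFunctions.ZetaZeros
import Literature.NumberTheory.LFunctions.ZetaZerosProofs
import Literature.NumberTheory.LFunctions.ZeroCounting
import Literature.NumberTheory.LFunctions.GeneralizedRH
import Literature.NumberTheory.LFunctions.SelbergZeroDensityNearHalf
import Literature.NumberTheory.LFunctions.RHWave0
import Literature.NumberTheory.LFunctions.ZeroStatistics
import Literature.NumberTheory.LFunctions.DensityHypothesisStatus
import Literature.NumberTheory.BeurlingPrimes.LindelofWitness
import Summits.RiemannHypothesis.RiemannHypothesis.Theorems.Splittings.PairCorrelationOffLineDensity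
import Summits.RiemannHypothesis.RiemannHypothesis.Theses.LindelofBridge
import Summits.RiemannHypothesis.RiemannHypothesis.Theses.RuelleBand
import Summits.RiemannHypothesis.RiemannHypothesis.Theorems.CofiniteCriticalLine.Negative.Reformulations
import Summits.RiemannHypothesis.RiemannHypothesis.Theorems.AsymptoticCriticalLine.Negative.KnownEnd
import Summits.RiemannHypothesis.RiemannHypothesis.Theorems.AsymptoticCriticalLine.Negative.LindelofHolds
import Summits.RiemannHypothesis.RiemannHypothesis.Theorems.AsymptoticCriticalLine.Negative.AlmostAll
import Summits.RiemannHypothesis.RiemannHypothesis.Theorems.Splittings.BombieriFozNoDep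
import Literature.Barriers.RiemannHypothesis.BohrDenseValuesProofs
import Literature.Barriers.RiemannHypothesis.BohrDenseValuesVoronin
import HarnessLib

/-!
# Splittings — the CONDITIONAL-COMPLEMENT axis (director-rh X4) for the zd family, typed (zero-def raw form)

Cell rh-split, seat rh-split-zd-neg gen 4 (card `cards/SPLIT-zd-neg.md` GEN-4; referee g2 01:39:04Z: DELIVERABLE,
labels N27–N29/N31–N33 CONDITIONAL-BOOKKEEPING immune complements, N30 COSTUME endpoint kernel-iff, N34 RELABELLING,
class unchanged; content PASS P5); scratch `HOME/rh-split-zd-neg/SketchG4.lean` sha16 4b9ded8a22ffddff §§0–3, §5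
(§4 calibration pointers and the re-display `example`s omitted); zero-def raw form by rh-split-typer-1 g3.
DICTIONARY (the seat's Props SPELLED OUT): `AlmostAll` = «off-line zeros are o(N(T))» =
`Tendsto (T ↦ (∑_{ρ ∈ box(0,T), Re ρ ≠ 1/2} riemannZetaZeroOrder ρ)/N(T)) atTop (𝓝 0)` (p475996's currency);
`DensityZeroToFinite` = `AlmostAll → {s | ζ s = 0 ∧ 1/2 < Re s}.Finite`; `DensityZeroToCofinite` =
`AlmostAll → RuelleBand.CofiniteCriticalLine`; `ProlifBeyond σ₀ θ` = «every zero with `σ₀ < Re s < 1` forces, at some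
`σ₀ < σ ≤ Re s`, a count `N(σ,T)` that is NOT `O(T^{θ σ})`».  Content: §1 IMMUNITY (`immune`: an RH-implied
complement cannot be refuted short of `¬RH`; every weakest complement below is RH-implied); §2 one H-free rigidity
statement (LindelofBridge's `ZeroOrInfinityLoc`) serves every row, each adding a SPARSE ⟹ FINITE step
(`rh_of_almostAll`, `rh_of_pcc`, `rh_of_gue`, costume probes `…_of_rh`, `immune_pieces`); §5 DEDUP against the tree's
sparsity ladder (route RuelleBand, cell row X-1): `cofiniteToExact_iff` («FOZ ⟹ RH» is the
EXISTING item `RuelleBand.CofiniteToExact`), `rh_of_pcc_tree`.  §3 (the PROLIFERATION currency) and the two proliferation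
rungs of §5 are in the companion file `ZdProliferationComplements.lean`.
Everything is RH-free bookkeeping or conditional; every complement is RH-IMPLIED; class zd×neg UNCHANGED.

HONEST LABEL: «SPLITTING SEARCH over kernel-typed RH-EQUIVALENCES; a splitting A ∧ B ⟹ RH is CONDITIONAL
bookkeeping unless A and B are both proved; nothing here bears on the truth of RH.»
-/

set_option linter.dupNamespace false
set_option linter.unusedVariables false

noncomputable section

namespace Summit.RiemannHypothesis.RiemannHypothesis.Theorems.Splittings.ZdConditionalComplements

open Complex Filter Set Topology Asymptotics
open scoped Real ComplexConjugate
open Literature.NumberTheory.LFunctions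
open Summit.RiemannHypothesis.RiemannHypothesis.Theses
open Summit.RiemannHypothesis.RiemannHypothesis.Theorems.Splittings

/-! ## §0 Bookkeeping: off-line zeros from `¬RH`, emptiness under RH -/

/-- `¬RH` produces a zero in the open right half of the critical strip (quasi-RH(1/2) ⟺ RH, tree). [folklore] -/
theorem exists_offLine_of_not_rh (h : ¬ RiemannHypothesis) :
    ∃ s : ℂ, riemannZeta s = 0 ∧ 1 / 2 < s.re ∧ s.re < 1 := by
  by_contra hne
  push Not at hne
  exact h (quasiRiemannHypothesis_one_half_iff_holds.1 fun s hs h0 h1 ↦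
    absurd h1 (not_lt.2 (hne s hs h0)))

/-- Under RH there is no zero with `Re s > 1/2`. [folklore] -/
theorem no_zero_beyond_half_of_rh (hRH : RiemannHypothesis) {s : ℂ} (hs : riemannZeta s = 0)
    (h : 1 / 2 < s.re) : False := by
  have hnt : ¬ ∃ n : ℕ, s = -2 * (n + 1) := by
    rintro ⟨n, hn⟩
    have := congrArg Complex.re hn
    simp at this
    have hn0 : (0 : ℝ) ≤ n := n.cast_nonneg
    linarith
  have hs1 : s ≠ 1 := by
    rintro rfl
    exact riemannZeta_one_ne_zero hs
  have := hRH s hs hnt hs1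
  linarith

/-- Under RH the set of zeros beyond any `σ ≥ 1/2` is empty. [folklore] -/
theorem zerosBeyond_eq_empty_of_rh (hRH : RiemannHypothesis) {σ : ℝ} (hσ : 1 / 2 ≤ σ) :
    {s : ℂ | riemannZeta s = 0 ∧ σ < s.re} = ∅ := by
  ext s
  simp only [mem_setOf_eq, mem_empty_iff_false, iff_false, not_and]
  exact fun hs h ↦ no_zero_beyond_half_of_rh hRH hs (lt_of_le_of_lt hσ h)

/-- Under RH the counting box beyond `σ > 1/2` is empty, so `N(σ, T) = 0`. [folklore] -/
theorem zetaZeroCountRe_eq_zero_of_rh (hRH : RiemannHypothesis) {σ : ℝ} (hσ : 1 / 2 < σ) (T : ℝ) :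
    zetaZeroCountRe σ T = 0 := by
  have hbox : zetaZeroBox σ T = ∅ := by
    ext s
    simp only [mem_empty_iff_false, iff_false]
    rintro ⟨hs, hre, -, -, -⟩
    exact no_zero_beyond_half_of_rh hRH hs (lt_of_lt_of_le hσ hre)
  simp [zetaZeroCountRe, hbox]

/-! ## §1 IMMUNITY — the neg-lens verdict on weakest complements -/

/-- A complement implied by RH is refutation-immune: refuting it disproves RH. [folklore] -/
theorem immune {A : Prop} (hA : RiemannHypothesis → A) : ¬ A → ¬ RiemannHypothesis := mt hA

-- The weakest complement of ANY hypothesis `H` is the costume `H → RH`, RH-implied: this is the landed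
-- `SparseRigid.rigid_of_rh` (not restated here: dedup).

/-! ## §2 The H-free rigidity statement and the SPARSE ⟹ FINITE steps -/

/-- The canonical zd-family X4 splitting: `100 % ∧ (o(N) ⟹ finite) ∧ (finite ⟹ none) ⟹ RH`, the last
conjunct being route LindelofBridge's `ZeroOrInfinityLoc` (stmt-RiemannHypothesis-10801) used at `σ₁ = 1/2`.
[folklore] -/
theorem rh_of_almostAll
    (hH : (Tendsto (fun T : ℝ ↦ ((∑ ρ ∈ ((zetaZeroBox_finite 0 T).toFinset).filter (fun ρ ↦ ρ.re ≠ 1 / 2),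
      riemannZetaZeroOrder ρ : ℤ) : ℝ) / zetaZeroCount T) atTop (𝓝 0)))
    (hA₁ : (Tendsto (fun T : ℝ ↦ ((∑ ρ ∈ ((zetaZeroBox_finite 0 T).toFinset).filter (fun ρ ↦ ρ.re ≠ 1 / 2),
      riemannZetaZeroOrder ρ : ℤ) : ℝ) / zetaZeroCount T) atTop (𝓝 0)) →
      Set.Finite {s : ℂ | riemannZeta s = 0 ∧ 1 / 2 < s.re})
    (hA₂ : LindelofBridge.ZeroOrInfinityLoc) : RiemannHypothesis :=
  quasiRiemannHypothesis_one_half_iff_holds.1 (hA₂ (1 / 2) le_rfl (hA₁ hH))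

/-- PCC row: Montgomery's pair-correlation conjecture (tree typing) with the same two-piece complement
gives RH — `H`'s whole contribution is `AlmostAll` (p475996). [folklore] -/
theorem rh_of_pcc (hPCC : MontgomeryPairCorrelation)
    (hA₁ : (Tendsto (fun T : ℝ ↦ ((∑ ρ ∈ ((zetaZeroBox_finite 0 T).toFinset).filter (fun ρ ↦ ρ.re ≠ 1 / 2),
      riemannZetaZeroOrder ρ : ℤ) : ℝ) / zetaZeroCount T) atTop (𝓝 0)) →
      Set.Finite {s : ℂ | riemannZeta s = 0 ∧ 1 / 2 < s.re})
    (hA₂ : LindelofBridge.ZeroOrInfinityLoc) : RiemannHypothesis :=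
  rh_of_almostAll (PairCorrelationOffLineDensity.offLine_density_tendsto_zero_of_pairCorrelation hPCC) hA₁ hA₂

/-- GUE row: the GUE hypothesis (all levels) contains the 2-level law, which is Montgomery's conjecture by
the named fact `gueHypothesisAt_one_iff_montgomery`; same complement. [folklore] -/
theorem rh_of_gue (hiff : gueHypothesisAt_one_iff_montgomery) (hGUE : GUEHypothesis)
    (hA₁ : (Tendsto (fun T : ℝ ↦ ((∑ ρ ∈ ((zetaZeroBox_finite 0 T).toFinset).filter (fun ρ ↦ ρ.re ≠
        1 / 2), riemannZetaZeroOrder ρ : ℤ) : ℝ) / zetaZeroCount T) atTop (𝓝 0)) →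
      Set.Finite {s : ℂ | riemannZeta s = 0 ∧
          1 / 2 < s.re}) (hA₂ : LindelofBridge.ZeroOrInfinityLoc) : RiemannHypothesis :=
  rh_of_pcc (hiff.1 (hGUE 1 le_rfl)) hA₁ hA₂

/-- Costume probe (i): `AlmostAll` is RH-implied (the off-line sum is identically `0`). [folklore] -/
theorem almostAll_of_rh (hRH : RiemannHypothesis) :
    (Tendsto (fun T : ℝ ↦ ((∑ ρ ∈ ((zetaZeroBox_finite 0 T).toFinset).filter (fun ρ ↦ ρ.re ≠ 1 / 2),
      riemannZetaZeroOrder ρ : ℤ) : ℝ) / zetaZeroCount T) atTop (𝓝 0)) := by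
  have h0 : ∀ T : ℝ, (∑ ρ ∈ ((zetaZeroBox_finite 0 T).toFinset).filter (fun ρ ↦ ρ.re ≠ 1 / 2),
      riemannZetaZeroOrder ρ : ℤ) = 0 := by
    intro T
    rw [Finset.sum_eq_zero]
    intro ρ hρ
    exfalso
    rw [Finset.mem_filter, Set.Finite.mem_toFinset] at hρ
    obtain ⟨⟨hζ, h0, h1, him, hT⟩, hre⟩ := hρ
    have hnt : ¬ ∃ n : ℕ, ρ = -2 * (n + 1) := by
      rintro ⟨n, hn⟩
      have := congrArg Complex.im hn
      simp at this
      linarith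
    have hρ1 : ρ ≠ 1 := by
      rintro rfl
      simp at him
    exact hre (hRH ρ hζ hnt hρ1)
  simp only [h0, Int.cast_zero, zero_div]
  exact tendsto_const_nhds

/-- Costume probe (ii): `DensityZeroToFinite` is RH-implied (vacuously: the set is empty) — immune. [folklore] -/
theorem densityZeroToFinite_of_rh (hRH : RiemannHypothesis) :
    (Tendsto (fun T : ℝ ↦ ((∑ ρ ∈ ((zetaZeroBox_finite 0 T).toFinset).filter (fun ρ ↦ ρ.re ≠ 1 / 2),
      riemannZetaZeroOrder ρ : ℤ) : ℝ) / zetaZeroCount T) atTop (𝓝 0)) →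
      Set.Finite {s : ℂ | riemannZeta s = 0 ∧ 1 / 2 < s.re} := fun _ ↦ by
  rw [zerosBeyond_eq_empty_of_rh hRH le_rfl]
  exact Set.finite_empty

/-- Costume probe (iii): `ZeroOrInfinityLoc` is RH-implied (vacuously) — immune. [folklore] -/
theorem zeroOrInfinityLoc_of_rh (hRH : RiemannHypothesis) : LindelofBridge.ZeroOrInfinityLoc :=
  fun σ₁ hσ₁ _ s hs h0 _ ↦ no_zero_beyond_half_of_rh hRH hs (lt_of_le_of_lt hσ₁ h0)

/-- Costume probe (iv): route LindelofBridge's `SparseRigidity` (the `T^ε`-currency SPARSE ⟹ FINITE step,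
stmt-RiemannHypothesis-1855) is RH-implied — immune. [folklore] -/
theorem sparseRigidity_of_rh (hRH : RiemannHypothesis) : LindelofBridge.SparseRigidity := by
  intro σ₁ hσ₁ _ σ hσ
  rw [zerosBeyond_eq_empty_of_rh hRH (hσ₁.trans hσ.le)]
  exact Set.finite_empty

/-- Costume probe (v): route LindelofBridge's `LindelofSparsityLow` is RH-implied (count `0`) — immune.
[folklore] -/
theorem lindelofSparsityLow_of_rh (hRH : RiemannHypothesis) : LindelofBridge.LindelofSparsityLow := by
  intro _ σ hσ _ ε _
  refine IsBigO.of_bound 1 (Eventually.of_forall fun T ↦ ?_)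
  rw [zetaZeroCountRe_eq_zero_of_rh hRH hσ]
  simp

/-- The neg-lens ledger for §2 in one line: each piece is immune. [folklore] -/
theorem immune_pieces :
    (¬ ((Tendsto (fun T : ℝ ↦ ((∑ ρ ∈ ((zetaZeroBox_finite 0 T).toFinset).filter (fun ρ ↦ ρ.re ≠
        1 / 2), riemannZetaZeroOrder ρ : ℤ) : ℝ) / zetaZeroCount T) atTop (𝓝 0)) →
        Set.Finite {s : ℂ | riemannZeta s = 0 ∧ 1 / 2 < s.re}) → ¬ RiemannHypothesis) ∧
        (¬ LindelofBridge.ZeroOrInfinityLoc → ¬ RiemannHypothesis) ∧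
    (¬ LindelofBridge.SparseRigidity → ¬ RiemannHypothesis) ∧
        (¬ (Tendsto (fun T : ℝ ↦ ((∑ ρ ∈ ((zetaZeroBox_finite 0 T).toFinset).filter (fun ρ ↦ ρ.re ≠
        1 / 2), riemannZetaZeroOrder ρ : ℤ) : ℝ) / zetaZeroCount T) atTop (𝓝 0)) → ¬ RiemannHypothesis) :=
  ⟨immune densityZeroToFinite_of_rh, immune zeroOrInfinityLoc_of_rh, immune sparseRigidity_of_rh,
    immune almostAll_of_rh⟩

/-! ## §5 DEDUP against the tree's SPARSITY LADDER (route RuelleBand, dormant) and the cell's row X-1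

The `FOZ ⟹ RH` half of every zd-row complement is NOT new: FOZ is the RuelleBand crux `CofiniteCriticalLine`
(stmt-RiemannHypothesis-2064) and `FOZ ⟹ X (⟹ RH)` is its support item `CofiniteToExact` (stmt-RiemannHypothesis-14746;
in print as Bombieri's 2000 trichotomy; cell row X-1 = `Splittings/BombieriFozNoDep.lean`). RuelleBand's rung #4
`AsymptoticCriticalLine` (ACL, stmt-RiemannHypothesis-2063) sits ABOVE LH and DH (tree, proved: `lindelof_of_acl'`,
`densityHypothesis_of_acl`), and the density-one BAND statement is a THEOREM (`tendsto_bandProportion_zero`). This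
section (i) identifies the two FIN currencies, (ii) re-targets the PCC/GUE/100 % row at the FOZ node so that its
second conjunct is the EXISTING item `CofiniteToExact`, (iii) places ACL as the top of the proliferation ladder
(`θ ≡ 0`), and (iv) re-displays Bagchi's RH-equivalence, a tree THEOREM, as the only proliferation engine in print. -/

/-- The two FIN currencies coincide: zeros beyond `1/2` automatically have `Re s < 1`. [folklore] -/
theorem rightHalf_eq :
    {s : ℂ | riemannZeta s = 0 ∧ 1 / 2 < s.re} = {s : ℂ | riemannZeta s = 0 ∧ 1 / 2 < s.re ∧ s.re < 1} := by
  ext s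
  simp only [Set.mem_setOf_eq]
  constructor
  · rintro ⟨hz, hs⟩
    exact ⟨hz, hs, lt_of_not_ge fun h ↦ riemannZeta_ne_zero_of_one_le_re h hz⟩
  · rintro ⟨hz, hs, -⟩
    exact ⟨hz, hs⟩

/-- FOZ (RuelleBand.CofiniteCriticalLine) ⟺ finitely many zeros beyond `Re s = 1/2` (this sketch's currency).
[folklore] -/
theorem cofinite_iff_finBeyondHalf :
    RuelleBand.CofiniteCriticalLine ↔ Set.Finite {s : ℂ | riemannZeta s = 0 ∧ 1 / 2 < s.re} := by
  rw [Summit.RiemannHypothesis.Cruxes.CofiniteCriticalLine.Negative.cofiniteCriticalLine_iff_rightHalf_finite,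
    ← rightHalf_eq]

/-- The two SPARSE ⟹ FINITE targets coincide (FOZ node ⟺ finitely many zeros beyond `1/2`). [folklore] -/
theorem densityZeroToCofinite_iff :
    ((Tendsto (fun T : ℝ ↦ ((∑ ρ ∈ ((zetaZeroBox_finite 0 T).toFinset).filter (fun ρ ↦ ρ.re ≠
        1 / 2), riemannZetaZeroOrder ρ : ℤ) : ℝ) / zetaZeroCount T) atTop (𝓝 0)) →
        RuelleBand.CofiniteCriticalLine) ↔
      ((Tendsto (fun T : ℝ ↦ ((∑ ρ ∈ ((zetaZeroBox_finite 0 T).toFinset).filter (fun ρ ↦ ρ.re ≠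
          1 / 2), riemannZetaZeroOrder ρ : ℤ) : ℝ) / zetaZeroCount T) atTop (𝓝 0)) →
        Set.Finite {s : ℂ | riemannZeta s = 0 ∧ 1 / 2 < s.re}) := by
  rw [cofinite_iff_finBeyondHalf]

/-- Under RH the first band is exact (no off-line zero in the open strip). [folklore] -/
theorem exactFirstBand_of_rh (hRH : RiemannHypothesis) : RuelleBand.ExactFirstBand :=
  fun s hs h0 h1 ↦ Or.inl (BombieriFozNoDep.re_eq_half_of_rh hRH
    (mem_riemannZetaNontrivialZeros_iff_holds.2 ⟨hs, h0, h1⟩))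

/-- RuelleBand's `CofiniteToExact` is exactly «FOZ ⟹ RH» (X ⟺ RH by `RuelleBand.closes` and the line above).
[folklore] -/
theorem cofiniteToExact_iff : RuelleBand.CofiniteToExact ↔ (RuelleBand.CofiniteCriticalLine →
      RiemannHypothesis) :=
  ⟨fun h hC ↦ Summit.RiemannHypothesis_iff.1 (RuelleBand.closes (h hC)),
   fun h hC ↦ exactFirstBand_of_rh (h hC)⟩

/-- LindelofBridge's localised ZOI (all `σ₁ ≥ 1/2`) contains RuelleBand's `CofiniteToExact` (its `σ₁ = 1/2` case).
[folklore] -/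
theorem cofiniteToExact_of_zoi (hZ : LindelofBridge.ZeroOrInfinityLoc) : RuelleBand.CofiniteToExact :=
  cofiniteToExact_iff.2 fun hC ↦
    quasiRiemannHypothesis_one_half_iff_holds.1 (hZ (1 / 2) le_rfl (cofinite_iff_finBeyondHalf.1 hC))

/-- **PCC row, tree-native form.** Complement = (o(N) ⟹ FOZ) ∧ `RuelleBand.CofiniteToExact`; the second conjunct is
an EXISTING item (stmt-RiemannHypothesis-14746), the conclusion passes through `RuelleBand.closes`. [folklore] -/
theorem rh_of_pcc_tree (hPCC : MontgomeryPairCorrelation)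
    (hA₁ : (Tendsto (fun T : ℝ ↦ ((∑ ρ ∈ ((zetaZeroBox_finite 0 T).toFinset).filter (fun ρ ↦ ρ.re ≠ 1 / 2),
      riemannZetaZeroOrder ρ : ℤ) : ℝ) / zetaZeroCount T) atTop (𝓝 0)) →
      RuelleBand.CofiniteCriticalLine)
    (hA₂ : RuelleBand.CofiniteToExact) : RiemannHypothesis :=
  Summit.RiemannHypothesis_iff.1
    (RuelleBand.closes (hA₂ (hA₁
      (PairCorrelationOffLineDensity.offLine_density_tendsto_zero_of_pairCorrelation hPCC))))

end Summit.RiemannHypothesis.RiemannHypothesis.Theorems.Splittings.ZdConditionalComplements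

end
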